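import Literature.Analysis.FluidPDE.SereginSverakBlowupRescaled
import HarnessLib

/-!
# Seregin–Šverák 2009, §§3–4: the hypotheses of Theorems 3.1–3.2 under shift-and-zoom

G. Seregin, V. Šverák, *On Type I singularities of the local axi-symmetric solutions of the
Navier–Stokes equations*, Comm. PDE 34 (2009) = arXiv:0804.1803. §3 (arXiv p. 9): "We recall
that the Navier–Stokes equations are invariant with respect to the following scaling:
`u(x,t) = λ v(λ x, λ² t)`, `p(x,t) = λ² q(λ x, λ² t)`. So, new functions `u` and `p` satisfy the
Navier–Stokes equations in a suitable domain"; §4 (p. 11) uses such "scaling arguments" to move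
the hypotheses of Thms. 3.1–3.2 between cylinders. This file PROVES, for the shift-and-zoom
`Φ(s, y) = (t₀ + c² s, c y)` with `0 < c ≤ 1`, `t₀ ≤ 0`, `t₀ - c² ≥ -1` (so that `Φ(Q) =
Q((t₀, 0), c) ⊆ Q`), that the rescaled pair `(c u ∘ Φ, c² p ∘ Φ)` inherits: the standing
assumptions of §3 with axial symmetry (`isAxisymmetricLocalSolution_rescale`, with the norm
bounds `lintegral_velocity_rescale`, `lintegral_pressure_rescale`: a factor `c⁻²`); (r2)
(`isBoundedAwayFromZero_rescale`); the decay bounds (r4)/(p2) (`ae_decay_rescale`, scale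
invariant); and, for the zoom at the origin (`t₀ = 0`), regularity of the origin pulls back
(`isRegularAtOrigin_of_rescale`). It also records the scale invariance of the pressure functional
`D` (`pressureD_shift_rescale`) and the rescaled pressure integral at a blow-up centre in terms of `D`
(`lintegral_pressure_rescaled_of_pressureD`). Used by `SereginSverakBlowupDecay`.

## References

* G. Seregin, V. Šverák, Comm. PDE 34 (2009), arXiv:0804.1803: §3 p. 9 (scaling, the
  functionals, regular points), §4 p. 11. [`SereginSverak2009`]
-/

noncomputable section

open MeasureTheory Set Function Filter Topology TopologicalSpace Module
open scoped NNReal ENNReal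

namespace Literature.Analysis.FluidPDE

namespace SereginSverak2009

/-- Local notation for physical space `ℝ³ = EuclideanSpace ℝ (Fin 3)`. -/
local notation "ℝ³" => EuclideanSpace ℝ (Fin 3)

/-! ### The shift-and-zoom `(s, y) ↦ (t₀ + c² s, c y)` -/

section Rescale

variable {u : ℝ → ℝ³ → ℝ³} {p : ℝ → ℝ³ → ℝ}

/-- `((0 : ℝ), 0 • e₃) = 0` in `ℝ × ℝ³`. [folklore] -/
theorem prod_zero_zero_smul_eZ : (((0 : ℝ), (0 : ℝ) • eZ) : ℝ × ℝ³) = 0 := by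
  simp

/-- For `0 < c ≤ 1`, `t₀ ≤ 0`, `t₀ - c² ≥ -1`, the map `Φ(s, y) = (t₀ + c² s, c y)` sends
`Q = Q(0, 1)` into `Q` (its image is `Q((t₀, 0), c)`). [folklore] -/
theorem parCyl_shift_subset {c t₀ : ℝ} (hc1 : c ≤ 1) (ht₀ : t₀ ≤ 0) (ht₁ : -1 ≤ t₀ - c ^ 2) :
    parCyl (t₀, (0 : ℝ) • eZ) c ⊆ parCyl (0 : ℝ × ℝ³) 1 := by
  have h := parCyl_subset_parCyl_zero_time (x₀ := (0 : ℝ) • eZ) (r := c) (r' := 1) ht₀ hc1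
    (by linarith)
  rwa [prod_zero_zero_smul_eZ] at h

/-- … and therefore `Q ⊆ Φ⁻¹(Q)`. [folklore] -/
theorem parCyl_one_subset_preimage {c t₀ : ℝ} (hc : 0 < c) (hc1 : c ≤ 1) (ht₀ : t₀ ≤ 0)
    (ht₁ : -1 ≤ t₀ - c ^ 2) :
    parCyl (0 : ℝ × ℝ³) 1 ⊆ stAffine (c ^ 2) c t₀ ((0 : ℝ) • eZ) ⁻¹' parCyl 0 1 := by
  have h1 : parCyl (0 : ℝ × ℝ³) 1 = stAffine (c ^ 2) c t₀ ((0 : ℝ) • eZ) ⁻¹'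
      parCyl (t₀, (0 : ℝ) • eZ) c := by
    rw [stAffine_preimage_parCyl hc, div_self hc.ne']
  calc parCyl (0 : ℝ × ℝ³) 1
      = stAffine (c ^ 2) c t₀ ((0 : ℝ) • eZ) ⁻¹' parCyl (t₀, (0 : ℝ) • eZ) c := h1
    _ ⊆ stAffine (c ^ 2) c t₀ ((0 : ℝ) • eZ) ⁻¹' parCyl 0 1 :=
      preimage_mono (parCyl_shift_subset hc1 ht₀ ht₁)

/-- `L³` bound of the rescaled velocity: `∫_Q |c u ∘ Φ|³ ≤ c⁻² ∫_Q |u|³`. [folklore] -/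
theorem lintegral_velocity_rescale {c t₀ : ℝ} (hc : 0 < c) (hc1 : c ≤ 1) (ht₀ : t₀ ≤ 0)
    (ht₁ : -1 ≤ t₀ - c ^ 2) :
    ∫⁻ z in parCyl 0 1, ‖(c • stPull (c ^ 2) c t₀ ((0 : ℝ) • eZ) u) z.1 z.2‖ₑ ^ (3 : ℕ) ≤
      ENNReal.ofReal (c ^ 2)⁻¹ * ∫⁻ z in parCyl 0 1, ‖u z.1 z.2‖ₑ ^ (3 : ℕ) := by
  have hdom : parCyl (0 : ℝ × ℝ³) 1 = stAffine (c ^ 2) c t₀ ((0 : ℝ) • eZ) ⁻¹'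
      parCyl (t₀, (0 : ℝ) • eZ) c := by
    rw [stAffine_preimage_parCyl hc, div_self hc.ne']
  nth_rewrite 1 [hdom]
  rw [setLIntegral_enorm_pow_stRescale (sq_pos_of_pos hc) hc, finrank_euclideanSpace_fin]
  calc ‖c‖ₑ ^ 3 * ENNReal.ofReal (c ^ 2 * c ^ 3)⁻¹ *
        ∫⁻ z in parCyl (t₀, (0 : ℝ) • eZ) c, ‖u z.1 z.2‖ₑ ^ 3
      ≤ ‖c‖ₑ ^ 3 * ENNReal.ofReal (c ^ 2 * c ^ 3)⁻¹ * ∫⁻ z in parCyl 0 1, ‖u z.1 z.2‖ₑ ^ 3 :=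
        mul_le_mul' le_rfl (lintegral_mono_set (parCyl_shift_subset hc1 ht₀ ht₁))
    _ = ENNReal.ofReal (c ^ 2)⁻¹ * ∫⁻ z in parCyl 0 1, ‖u z.1 z.2‖ₑ ^ 3 := by
        congr 1
        rw [Real.enorm_eq_ofReal hc.le, ← ENNReal.ofReal_pow hc.le,
          ← ENNReal.ofReal_mul (by positivity)]
        congr 1
        field_simp

/-- `‖c²‖ₑ^{3/2} = c³` for `c ≥ 0`. [folklore] -/
theorem enorm_sq_rpow_threeHalves {c : ℝ} (hc : 0 ≤ c) :
    ‖c ^ 2‖ₑ ^ (3 / 2 : ℝ) = ENNReal.ofReal (c ^ 3) := by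
  rw [Real.enorm_eq_ofReal (sq_nonneg c), ENNReal.ofReal_rpow_of_nonneg (sq_nonneg c)
    (by norm_num)]
  congr 1
  rw [← Real.rpow_natCast c 2, ← Real.rpow_mul hc, ← Real.rpow_natCast c 3]
  norm_num

/-- `L^{3/2}` bound of the rescaled pressure: `∫_Q |c² p ∘ Φ|^{3/2} ≤ c⁻² ∫_Q |p|^{3/2}`.
[folklore] -/
theorem lintegral_pressure_rescale {c t₀ : ℝ} (hc : 0 < c) (hc1 : c ≤ 1) (ht₀ : t₀ ≤ 0)
    (ht₁ : -1 ≤ t₀ - c ^ 2) :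
    ∫⁻ z in parCyl 0 1, ‖(c ^ 2 • stPull (c ^ 2) c t₀ ((0 : ℝ) • eZ) p) z.1 z.2‖ₑ ^ (3 / 2 : ℝ) ≤
      ENNReal.ofReal (c ^ 2)⁻¹ * ∫⁻ z in parCyl 0 1, ‖p z.1 z.2‖ₑ ^ (3 / 2 : ℝ) := by
  have hdom : parCyl (0 : ℝ × ℝ³) 1 = stAffine (c ^ 2) c t₀ ((0 : ℝ) • eZ) ⁻¹'
      parCyl (t₀, (0 : ℝ) • eZ) c := by
    rw [stAffine_preimage_parCyl hc, div_self hc.ne']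
  nth_rewrite 1 [hdom]
  rw [setLIntegral_enorm_rpow_stRescale (sq_pos_of_pos hc) hc t₀ _ (c ^ 2) p _
    (by norm_num : (0 : ℝ) ≤ 3 / 2), finrank_euclideanSpace_fin, enorm_sq_rpow_threeHalves hc.le]
  calc ENNReal.ofReal (c ^ 3) * ENNReal.ofReal (c ^ 2 * c ^ 3)⁻¹ *
        ∫⁻ z in parCyl (t₀, (0 : ℝ) • eZ) c, ‖p z.1 z.2‖ₑ ^ (3 / 2 : ℝ)
      ≤ ENNReal.ofReal (c ^ 3) * ENNReal.ofReal (c ^ 2 * c ^ 3)⁻¹ *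
        ∫⁻ z in parCyl 0 1, ‖p z.1 z.2‖ₑ ^ (3 / 2 : ℝ) :=
        mul_le_mul' le_rfl (lintegral_mono_set (parCyl_shift_subset hc1 ht₀ ht₁))
    _ = ENNReal.ofReal (c ^ 2)⁻¹ * ∫⁻ z in parCyl 0 1, ‖p z.1 z.2‖ₑ ^ (3 / 2 : ℝ) := by
        congr 1
        rw [← ENNReal.ofReal_mul (by positivity)]
        congr 1
        field_simp

/-- **The hypotheses of Thms. 3.1–3.2 are preserved by the shift-and-zoom** `Φ(s, y) =
(t₀ + c² s, c y)`, `0 < c ≤ 1`, `t₀ ≤ 0`, `t₀ - c² ≥ -1`: the pair `(c u ∘ Φ, c² p ∘ Φ)` again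
satisfies the standing assumptions of §3 with axial symmetry (distributional equations by
covariance and restriction, `L³`/`L^{3/2}` bounds by change of variables, axial symmetry because
`Φ` is centred on the axis). [cite: SereginSverak2009, §3 ("new functions `u` and `p` satisfy the Navier–Stokes equations in a suitable domain", arXiv p. 9) and §4 ("scaling arguments")] -/
theorem isAxisymmetricLocalSolution_rescale (hsol : IsAxisymmetricLocalSolution u p) {c t₀ : ℝ}
    (hc : 0 < c) (hc1 : c ≤ 1) (ht₀ : t₀ ≤ 0) (ht₁ : -1 ≤ t₀ - c ^ 2) :
    IsAxisymmetricLocalSolution (c • stPull (c ^ 2) c t₀ ((0 : ℝ) • eZ) u)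
      (c ^ 2 • stPull (c ^ 2) c t₀ ((0 : ℝ) • eZ) p) where
  distributional := isDistributional_rescaled hsol.distributional hc t₀ _
    (parCyl_one_subset_preimage hc hc1 ht₀ ht₁)
  velocity_L3 := (lintegral_velocity_rescale hc hc1 ht₀ ht₁).trans_lt
    (ENNReal.mul_lt_top ENNReal.ofReal_lt_top hsol.velocity_L3)
  pressure_L32 := (lintegral_pressure_rescale hc hc1 ht₀ ht₁).trans_lt
    (ENNReal.mul_lt_top ENNReal.ofReal_lt_top hsol.pressure_L32)
  axisymmetric s hs := by
    have hs' : s ∈ Ioo (-(1 : ℝ) ^ 2) 0 := by simpa using hs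
    have h1 := parCyl_one_subset_preimage hc hc1 ht₀ ht₁ (mem_parCyl_zero_of_time one_pos hs')
    rw [mem_preimage, mem_parCyl_zero, stAffine_fst] at h1
    have ht : t₀ + c ^ 2 * s ∈ Ioo (-1 : ℝ) 0 := by simpa using h1.1
    exact isAxisymmetric_rescale (hsol.axisymmetric _ ht) c 0 c

/-- **(r2) is preserved** (`t₀ ≤ 0`): a bound on `𝒞 × ]-1, -(ca)²[` for `u` gives a bound on
`𝒞 × ]-1, -a²[` for `c u ∘ Φ`. [cite: SereginSverak2009, Thm. 3.2 (r2)] -/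
theorem isBoundedAwayFromZero_rescale (hr2 : IsBoundedAwayFromZero u) {c t₀ : ℝ} (hc : 0 < c)
    (hc1 : c ≤ 1) (ht₀ : t₀ ≤ 0) (ht₁ : -1 ≤ t₀ - c ^ 2) :
    IsBoundedAwayFromZero (c • stPull (c ^ 2) c t₀ ((0 : ℝ) • eZ) u) := by
  intro a ha
  have hca : c * a ∈ Ioo (0 : ℝ) 1 := ⟨mul_pos hc ha.1, by nlinarith [ha.2, ha.1]⟩
  obtain ⟨K, hK⟩ := hr2 (c * a) hca
  refine ⟨c * K, ?_⟩
  have h1 := ae_restrict_preimage_stAffine (sq_pos_of_pos hc) hc t₀ ((0 : ℝ) • eZ) hK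
  filter_upwards [ae_restrict_of_ae_restrict_of_subset
    (parCyl_one_subset_preimage hc hc1 ht₀ ht₁) h1] with z hz hza
  rw [stAffine_fst, stAffine_snd] at hz
  have ht : t₀ + c ^ 2 * z.1 < -(c * a) ^ 2 := by nlinarith [pow_pos hc 2]
  rw [smul_stPull_apply, norm_smul, Real.norm_eq_abs, abs_of_pos hc]
  exact mul_le_mul_of_nonneg_left (hz ht) hc.le

/-- **(r4)/(p2) are scale invariant**: an a.e. bound `|x'| ‖u‖ ≤ A` on a set `S` gives
`|y'| ‖c u ∘ Φ‖ ≤ A` a.e. on every `Q(0, R)` that `Φ(s, y) = (t₀ + c² s, b e₃ + c y)` maps into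
`S`. [cite: SereginSverak2009, Thm. 3.2 (r4) and §4 (p2), (p10)] -/
theorem ae_decay_rescale {A c t₀ b R : ℝ} (hc : 0 < c) {S : Set (ℝ × ℝ³)}
    (hA : ∀ᵐ z ∂(volume.restrict S), cylRadius z.2 * ‖u z.1 z.2‖ ≤ A)
    (hmaps : parCyl 0 R ⊆ stAffine (c ^ 2) c t₀ (b • eZ) ⁻¹' S) :
    ∀ᵐ z ∂(volume.restrict (parCyl 0 R)),
      cylRadius z.2 * ‖(c • stPull (c ^ 2) c t₀ (b • eZ) u) z.1 z.2‖ ≤ A := by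
  have h8 := ae_restrict_preimage_stAffine (sq_pos_of_pos hc) hc t₀ (b • eZ) hA
  filter_upwards [ae_restrict_of_ae_restrict_of_subset hmaps h8] with z hz
  simp only [stAffine_fst, stAffine_snd, cylRadius_smul_eZ_add, cylRadius_smul,
    abs_of_pos hc] at hz
  rw [smul_stPull_apply, norm_smul, Real.norm_eq_abs, abs_of_pos hc]
  calc cylRadius z.2 * (c * ‖u (t₀ + c ^ 2 * z.1) (b • eZ + c • z.2)‖)
        = c * cylRadius z.2 * ‖u (t₀ + c ^ 2 * z.1) (b • eZ + c • z.2)‖ := by ring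
    _ ≤ A := hz

/-- **Regularity of the origin is scale invariant** (zoom `t₀ = 0`): if `c u(c² s, c y)` is
essentially bounded on some `Q(r)`, then `u` is essentially bounded on `Q(c r)`.
[cite: SereginSverak2009, §3 (definition of regular point, arXiv p. 9)] -/
theorem isRegularAtOrigin_of_rescale {c : ℝ} (hc : 0 < c)
    (h : IsRegularAtOrigin (c • stPull (c ^ 2) c 0 ((0 : ℝ) • eZ) u)) : IsRegularAtOrigin u := by
  obtain ⟨r, hr, hfin⟩ := h
  set U := c • stPull (c ^ 2) c 0 ((0 : ℝ) • eZ) u with hU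
  set E := eLpNorm (uncurry U) ∞ (volume.restrict (parCyl 0 r)) with hE
  have hEtop : E ≠ ∞ := hfin.ne
  -- a.e. bound for the zoomed field on `Q(r)`
  have hae : ∀ᵐ z ∂(volume.restrict (parCyl 0 r)), ‖uncurry U z‖ ≤ E.toReal := by
    have h1 := ae_le_essSup (μ := volume.restrict (parCyl 0 r)) (f := fun z => ‖uncurry U z‖ₑ)
    filter_upwards [h1] with z hz
    rw [← ENNReal.ofReal_le_iff_le_toReal hEtop, ofReal_norm]
    simpa [hE, eLpNorm_exponent_top, eLpNormEssSup] using hz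
  -- transport back to `Q(c r)`
  have hdom : parCyl (0 : ℝ × ℝ³) r =
      stAffine (c ^ 2) c 0 ((0 : ℝ) • eZ) ⁻¹' parCyl ((0 : ℝ), (0 : ℝ) • eZ) (c * r) := by
    rw [stAffine_preimage_parCyl hc, mul_div_cancel_left₀ _ hc.ne']
  have hae' : ∀ᵐ z ∂(volume.restrict (stAffine (c ^ 2) c 0 ((0 : ℝ) • eZ) ⁻¹'
      parCyl ((0 : ℝ), (0 : ℝ) • eZ) (c * r))),
      c * ‖uncurry u (stAffine (c ^ 2) c 0 ((0 : ℝ) • eZ) z)‖ ≤ E.toReal := by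
    rw [← hdom]
    filter_upwards [hae] with z hz
    have e : uncurry U z = c • uncurry u (stAffine (c ^ 2) c 0 ((0 : ℝ) • eZ) z) := rfl
    rwa [e, norm_smul, Real.norm_eq_abs, abs_of_pos hc] at hz
  have hback := ae_restrict_of_ae_restrict_preimage_stAffine (sq_pos_of_pos hc) hc 0
    ((0 : ℝ) • eZ) (P := fun w => c * ‖uncurry u w‖ ≤ E.toReal) hae'
  rw [prod_zero_zero_smul_eZ] at hback
  refine ⟨c * r, mul_pos hc hr, ?_⟩
  rw [eLpNorm_exponent_top]
  refine lt_of_le_of_lt (eLpNormEssSup_le_of_ae_bound (C := E.toReal / c) ?_)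
    ENNReal.ofReal_lt_top
  filter_upwards [hback] with z hz
  rw [le_div_iff₀ hc, mul_comm]
  exact hz

/-- The preimage of `Q((t₀, x₀ + c y₁), r)` under `Φ(s, y) = (t₀ + c² s, x₀ + c y)` is
`Q((0, y₁), r/c)` (`c > 0`). [folklore] -/
theorem stAffine_preimage_parCyl_add {c : ℝ} (hc : 0 < c) (t₀ : ℝ) (x₀ y₁ : ℝ³) (r : ℝ) :
    stAffine (c ^ 2) c t₀ x₀ ⁻¹' parCyl (t₀, x₀ + c • y₁) r = parCyl ((0 : ℝ), y₁) (r / c) := by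
  ext ⟨s, y⟩
  rw [mem_preimage, stAffine_apply, mem_parCyl, mem_parCyl]
  simp only [mem_Ioo, PiLp.add_apply, PiLp.smul_apply, smul_eq_mul]
  have e1 : x₀ + c • y - (x₀ + c • y₁) = c • (y - y₁) := by rw [smul_sub]; abel
  have e2 : x₀ 2 + c * y 2 - (x₀ 2 + c * y₁ 2) = c * (y 2 - y₁ 2) := by ring
  have hc2 : 0 < c ^ 2 := by positivity
  rw [e1, e2, cylRadius_smul, abs_of_pos hc, abs_mul, abs_of_pos hc, div_pow, lt_div_iff₀ hc,
    lt_div_iff₀ hc, show (0 : ℝ) - r ^ 2 / c ^ 2 = (-(r ^ 2)) / c ^ 2 by ring, div_lt_iff₀ hc2]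
  constructor
  · rintro ⟨⟨h1, h2⟩, h3, h4⟩
    exact ⟨⟨by linarith, by nlinarith⟩, by linarith, by linarith⟩
  · rintro ⟨⟨h1, h2⟩, h3, h4⟩
    exact ⟨⟨by linarith, by nlinarith⟩, by linarith, by linarith⟩

/-- **Scale invariance of the pressure functional**: `D((0, y₁), r/c; c² q ∘ Φ) =
D((t₀, x₀ + c y₁), r; q)` for `Φ(s, y) = (t₀ + c² s, x₀ + c y)`, `c, r > 0`.
[cite: SereginSverak2009, §3 ("scale-invariant functionals", arXiv p. 9)] -/
theorem pressureD_shift_rescale {c r : ℝ} (hc : 0 < c) (hr : 0 < r) (t₀ : ℝ) (x₀ y₁ : ℝ³)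
    (q : ℝ → ℝ³ → ℝ) :
    pressureD ((0 : ℝ), y₁) (r / c) (c ^ 2 • stPull (c ^ 2) c t₀ x₀ q) =
      pressureD (t₀, x₀ + c • y₁) r q := by
  rw [pressureD, pressureD, ← stAffine_preimage_parCyl_add hc t₀ x₀ y₁ r,
    setLIntegral_enorm_rpow_stRescale (sq_pos_of_pos hc) hc t₀ x₀ (c ^ 2) q _
      (by norm_num : (0 : ℝ) ≤ 3 / 2), finrank_euclideanSpace_fin, enorm_sq_rpow_threeHalves hc.le,
    ← mul_assoc, ← mul_assoc]
  congr 1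
  have hrc : 0 < r / c := div_pos hr hc
  rw [← ENNReal.ofReal_pow hrc.le, ← ENNReal.ofReal_pow hr.le,
    ← ENNReal.ofReal_inv_of_pos (by positivity), ← ENNReal.ofReal_inv_of_pos (by positivity),
    ← ENNReal.ofReal_mul (by positivity), ← ENNReal.ofReal_mul (by positivity)]
  congr 1
  field_simp

/-- **The rescaled pressure at a blow-up centre** (no time shift): if `D((t_k, x₀), aλ; q) ≤ C₁`
then `∫_{Q(0,a)} |λ² q ∘ Φ|^{3/2} ≤ a² C₁` for `Φ(s, y) = (t_k + λ² s, x₀ + λ y)`.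
[cite: SereginSverak2009, §4 (the estimate on `F^k`, arXiv p. 11)] -/
theorem lintegral_pressure_rescaled_of_pressureD {q : ℝ → ℝ³ → ℝ} {c a tk : ℝ} {x₀ : ℝ³}
    {C₁ : ℝ≥0} (hc : 0 < c) (ha : 0 < a) (hD : pressureD (tk, x₀) (a * c) q ≤ C₁) :
    ∫⁻ z in parCyl 0 a, ‖(c ^ 2 • stPull (c ^ 2) c tk x₀ q) z.1 z.2‖ₑ ^ (3 / 2 : ℝ) ≤
      ENNReal.ofReal (a ^ 2) * C₁ := by
  have hac : 0 < a * c := mul_pos ha hc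
  have hdom : parCyl (0 : ℝ × ℝ³) a = stAffine (c ^ 2) c tk x₀ ⁻¹' parCyl (tk, x₀) (a * c) := by
    rw [stAffine_preimage_parCyl hc, mul_div_cancel_right₀ _ hc.ne']
  rw [hdom, setLIntegral_enorm_rpow_stRescale (sq_pos_of_pos hc) hc tk x₀ (c ^ 2) q _
    (by norm_num : (0 : ℝ) ≤ 3 / 2), finrank_euclideanSpace_fin, enorm_sq_rpow_threeHalves hc.le,
    setLIntegral_eq_mul_pressureD _ hac, ← ENNReal.ofReal_pow hac.le]
  calc ENNReal.ofReal (c ^ 3) * ENNReal.ofReal (c ^ 2 * c ^ 3)⁻¹ *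
        (ENNReal.ofReal ((a * c) ^ 2) * pressureD (tk, x₀) (a * c) q)
      ≤ ENNReal.ofReal (c ^ 3) * ENNReal.ofReal (c ^ 2 * c ^ 3)⁻¹ *
        (ENNReal.ofReal ((a * c) ^ 2) * C₁) := by gcongr
    _ = ENNReal.ofReal (c ^ 3 * (c ^ 2 * c ^ 3)⁻¹ * (a * c) ^ 2) * C₁ := by
        rw [ENNReal.ofReal_mul (by positivity), ENNReal.ofReal_mul (by positivity)]
        ring
    _ = ENNReal.ofReal (a ^ 2) * C₁ := by
        congr 2
        field_simp

end Rescale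

end SereginSverak2009

end Literature.Analysis.FluidPDE
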